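/-
Origin: expansion seat `prover-pub-hodgecm-mc-carch-1-g5-0`, handover #CA50 2026-08-20T11:04:23Z md5 e7c39412f262 (370 l., 9 decls; NEW additive leaf; imports RUN-49 #CA49 Model.ArchKTypeOfLineTables34 + installed RUN-45 #CA36 Model.ArchKTypeOfSigma + installed (K7) Model.ArchConjTorusTransport + installed Model.ThetaAdelicSideReadOff; RUN 50; drop-alone; cert certs/ax-ArchKTypeOfSigmaConj-e7c39412f262.log: rc 0 / 29 s / 0 warnings / trio) (`HOME/mc/pub-hodgecm-mc-carch-1/pkg50/HodgeCM/Model/ArchKTypeOfSigmaConj.lean`, md5 e7c39412f262, 370 lines);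
landed by the second packager p2 gen 7 (p2-g7) in gate run 50 as `HodgeCM/Model/ArchKTypeOfSigmaConj.lean` (verbatim).
-/
/-
Copyright (c) 2026. Released under Apache 2.0 license as described in the file LICENSE.
Cell pub-hodgecm, MODEL layer (construction prover mc-carch-1, gen 5), BINDER-OWNERS rows 12 / 18 / 19, junction (C-Σ)′:
the see-saw CONSISTENCY of the definite-place exponents for the CONJUGATED plane — `pairVacExponent = a₂ + a₃ + ℓ′_b`,
i.e. `nVR = nVR₂` off `v₁` (pin R2 is consistent with pin R1 on the shared `χV`), from the (STRIP) ∧ (VT) input `hSV` of (K10).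
-/
import Summits.HodgeConjecture.HodgeCM.Model.ArchKTypeOfLineTables34
import Summits.HodgeConjecture.HodgeCM.Model.ArchKTypeOfSigma
import Summits.HodgeConjecture.HodgeCM.Model.ArchConjTorusTransport_2
import Summits.HodgeConjecture.HodgeCM.Model.ThetaAdelicSideReadOff

/-!
# (C-Σ)′: at a definite place the pair's vacuum exponent is `a₂ b + a₃ b + ℓ′_b` — the R1/R2 consistency `nVR = nVR₂` off `v₁`

Lines 2, 3 live on the conjugated plane `isoGL · diag(a₂,a₃) · isoGL⁻¹`.  Their pin (R2) reads the SAME `χV` as lines 0, 1 (one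
`η = EtaChi.η χV χW` for the W pin and the S pin), so the (c5)₂ input of row 12 at the shared `χV := χVR` (type `nVR`, #CA33; `= −pairVacExponent`
off `v₁`, #CA36) holds iff the line-2 table `nVR₂ (w b) = −a₂ b − a₃ b − ℓ′_b` (#CA49) agrees with it, i.e. iff

  **(C-Σ)′  `pairVacExponent V c.D hGR h₁W b = defExponentTwo … b + defExponentThree … b + defLambdaExponentConj … b hb`  (`b ≠ v₁`).**

Proof (the #CA36 argument on the conjugated see-saw): K-1's `cmPairRepTwist_conjTorusIdeles_cmConjLineTensorFin`
([Howe1979 §3; Kudla1984 §1; GelbartRogawski1991 §3.1 Remark p. 457]) at `((archSingle (w b) u)^𝔸, 1)`, trivial twists, on the conjugated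
see-saw tensor `X = φ₁(Φ₂) ⊗‴ φ₁(Φ₃)` of the two line vectors: the line sides act by `det(u)^{ℓ′_b + a₂ b}` (#CA48 `defLambdaCharConj_eq_zpow`,
#CA49 `defExponentTwo_spec`) and `det(u)^{a₃ b}`; `X ≠ 0` (sinst `cmConjLineTensorFin_ne_zero`).  The BIG side needs the archimedean factor of
`X`: this is exactly theta-3 (K10)'s input `hSV` = period-1's (STRIP) ∧ (VT) (`Model/ArchConjSlotVT.exists_strip_vt_of_leviShape`, from
sinst-1's Levi shape): `X = E(Y ⊗ F)` with `Y = a • ω_∞(hGR)(1, conjTransportK c.D) (ctxSlotArchBox V c)`.  Since `ω_∞(hGR)` is a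
representation of the PRODUCT `U(V)_∞ × U(W)_∞`, `ω_∞(archSingle u, 1)` commutes with `ω_∞(1, k)` and acts on the context's slot box by
`det(u)^{pairVacExponent b}` (#CA36 § 1) — so it acts on `Y` by the same scalar (§ 1 here), with NO extra cocycle character.  Comparing
the two scalars on `X ≠ 0` at elements of every unit determinant (#CA36 `exists_archLocal_det_eq`) gives the integer identity (#CA21).

* § 1 `cmArchWeilRep_archSingle_of_vt` — the big side on `Y`;
* § 2 `cmConjLineRepFin₀/₁_one_archSingle_testFun` — the line sides;
* § 3 `det_zpow_pairVacExponent_eq_conj_of_strip_vt`, **`pairVacExponent_eq_conj_of_strip_vt`**, **`nVR₂_eq_neg_pairVacExponent_of_strip_vt`**,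
  **`nVR_eq_nVR₂_of_strip_vt`** — per context, hypotheses `(Y) (F) (hstrip) (a) (hY)` in (K10)'s shape;
* § 4 **`SInstance.nVR_eq_nVR₂_of_GOG`** — the guarded family form consuming (K10)'s ∀-packaged `hSV` VERBATIM (the term glue-1 feeds to
  `hΔ₂/hΔ₃_GOG_muSharp₂₃` is fed here unchanged).

0 records, 0 `def … : Prop`, nothing cited as a hypothesis; `hSV` is a kernel statement about constructed objects, discharged by period-1/sinst-1.
-/

set_option autoImplicit false

noncomputable section

open NumberField NumberField.InfinitePlace NumberField.mixedEmbedding IsDedekindDomain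
open scoped Matrix Classical TensorProduct SchwartzMap
open ComplexConjugate MvPolynomial
open Literature.NumberTheory.Automorphic Literature.NumberTheory.Automorphic.UnitaryGroup Literature.NumberTheory.Weil1964
open Literature.NumberTheory.GelbartRogawski1991 Literature.NumberTheory.GelbartRogawski1991.UnitaryDualPair
open Literature.RepresentationTheory.KonnoKonno2007
open Literature.RepresentationTheory (atPlace)
open Literature.Analysis.SegalBargmann
open HodgeCM.Adelic HodgeCM.PerL34 HodgeCM.Model.HypCensus HodgeCM.Model.ArchSideTerm HodgeCM.Model.SupplyInstance

namespace HodgeCM.Model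

section SigmaConj

variable {L : CMField} {ι₁ : L →+* ℂ} (V : HermSpace3 L ι₁) (c : SeesawCtx L)
variable
  (hGR : (cmSplittingDatum (L : Type) finProdFinEquiv (frameD V) (frameD_real V) (frameD_ne V) (dW c.D) (dW_real c.D) (dW_ne c.D)).CompatibleSplitting)
  (hGR₀ : (cmSplittingDatum (L : Type) (e₁) (frameD V) (frameD_real V) (frameD_ne V) (lineVec (L : Type) (dW c.D 0))
    (fun _ => dW_real c.D 0) (fun _ => dW_ne c.D 0)).CompatibleSplitting)
  (hGR₁ : (cmSplittingDatum (L : Type) (e₁) (frameD V) (frameD_real V) (frameD_ne V) (lineVec (L : Type) (dW c.D 1))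
    (fun _ => dW_real c.D 1) (fun _ => dW_ne c.D 1)).CompatibleSplitting)
  (hGR₂ : (cmSplittingDatum (L : Type) (e₁) (frameD V) (frameD_real V) (frameD_ne V) (lineVec (L : Type) (dW' c.D 0))
    (fun _ => dW'_real c.D 0) (fun _ => dW'_ne c.D 0)).CompatibleSplitting)
  (hGR₃ : (cmSplittingDatum (L : Type) (e₁) (frameD V) (frameD_real V) (frameD_ne V) (lineVec (L : Type) (dW' c.D 1))
    (fun _ => dW'_real c.D 1) (fun _ => dW'_ne c.D 1)).CompatibleSplitting)
  (h₁W : (∀ j, 0 < (ι₁ (dW c.D j)).re) ∨ ∀ j, (ι₁ (dW c.D j)).re < 0)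
  (hpos₀ : 0 < cmXW (L : Type) (frameD V) (lineVec (L : Type) (dW c.D 0)) (fun _ => dW_real c.D 0) ι₁ (HypCensus.cmPlace (L : Type) ι₁) 0)
  (hpos₁ : 0 < cmXW (L : Type) (frameD V) (lineVec (L : Type) (dW c.D 1)) (fun _ => dW_real c.D 1) ι₁ (HypCensus.cmPlace (L : Type) ι₁) 0)
  (hpos₂ : 0 < cmXW (L : Type) (frameD V) (lineVec (L : Type) (dW' c.D 0)) (fun _ => dW'_real c.D 0) ι₁ (HypCensus.cmPlace (L : Type) ι₁) 0)
  (hpos₃ : 0 < cmXW (L : Type) (frameD V) (lineVec (L : Type) (dW' c.D 1)) (fun _ => dW'_real c.D 1) ι₁ (HypCensus.cmPlace (L : Type) ι₁) 0)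

/-! ## § 1 The big pair on the transported slot box `Y = a • ω_∞(1, k) (ctxSlotArchBox)` -/

/-- **the big pair acts on the transported slot box `Y = a • ω_∞(1, conjTransportK)(ctxSlotArchBox)` by `det(u)^{pairVacExponent b}`**
(`b ≠ v₁`): `ω_∞(u, 1)` and `ω_∞(1, k)` commute in the representation of the product group, and `ω_∞(u, 1)` acts on the context's slot
box by that scalar (#CA36 § 1) — no extra cocycle character appears. -/
theorem cmArchWeilRep_archSingle_of_vt (Y : 𝓢((Fin (3 * 2) → mixedSpace (↥(NumberField.maximalRealSubfield (L : Type)))), ℂ)) (a : ℂ)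
    (hY : Y = a • HypCensus.cmArchWeilRep (L : Type) finProdFinEquiv (frameD V) (frameD_real V) (frameD_ne V) (dW c.D) (dW_real c.D) (dW_ne c.D)
        hGR (1, conjTransportK c.D) (ctxSlotArchBox V c hpos₀ hpos₁))
    {b : {v : InfinitePlace ↥(maximalRealSubfield L) // v.IsReal}}
    (hb : b ≠ HypCensus.cmPlace (L : Type) ι₁) (u : archLocal (L : Type) 3 (Matrix.diagonal (frameD V)) (cmPlaceOver (L : Type) b)) :
    cmArchWeilRep (L : Type) finProdFinEquiv (frameD V) (frameD_real V) (frameD_ne V) (dW c.D) (dW_real c.D) (dW_ne c.D) hGR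
        (UnitaryGroup.archSingle (↥(maximalRealSubfield L)) L (IsCMField.complexConj L) 3 (Matrix.diagonal (frameD V))
          (IsCMField.complexConj_ne_one L) (UnitaryGroup.complexConj_smul_infinitePlace (L : Type)) (cmPlaceOver (L : Type) b) u, 1) Y =
      (((u : archLocal (L : Type) 3 (Matrix.diagonal (frameD V)) (cmPlaceOver (L : Type) b)) : GL (Fin 3) ℂ) : Matrix (Fin 3) (Fin 3) ℂ).det ^
          pairVacExponent V c.D hGR h₁W b • Y := by
  subst hY
  have hcomm : ((UnitaryGroup.archSingle (↥(maximalRealSubfield L)) L (IsCMField.complexConj L) 3 (Matrix.diagonal (frameD V))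
        (IsCMField.complexConj_ne_one L) (UnitaryGroup.complexConj_smul_infinitePlace (L : Type)) (cmPlaceOver (L : Type) b) u, 1) :
        UnitaryGroup.arch (↥(maximalRealSubfield L)) L (IsCMField.complexConj L) 3 (Matrix.diagonal (frameD V)) ×
          UnitaryGroup.arch (↥(maximalRealSubfield L)) L (IsCMField.complexConj L) 2 (Matrix.diagonal (dW c.D))) * (1, conjTransportK c.D) =
      (1, conjTransportK c.D) *
        (UnitaryGroup.archSingle (↥(maximalRealSubfield L)) L (IsCMField.complexConj L) 3 (Matrix.diagonal (frameD V))
          (IsCMField.complexConj_ne_one L) (UnitaryGroup.complexConj_smul_infinitePlace (L : Type)) (cmPlaceOver (L : Type) b) u, 1) := by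
    rw [Prod.mk_mul_mk, Prod.mk_mul_mk, one_mul, mul_one, one_mul, mul_one]
  have hswap : cmArchWeilRep (L : Type) finProdFinEquiv (frameD V) (frameD_real V) (frameD_ne V) (dW c.D) (dW_real c.D) (dW_ne c.D) hGR
        (UnitaryGroup.archSingle (↥(maximalRealSubfield L)) L (IsCMField.complexConj L) 3 (Matrix.diagonal (frameD V))
          (IsCMField.complexConj_ne_one L) (UnitaryGroup.complexConj_smul_infinitePlace (L : Type)) (cmPlaceOver (L : Type) b) u, 1)
        (cmArchWeilRep (L : Type) finProdFinEquiv (frameD V) (frameD_real V) (frameD_ne V) (dW c.D) (dW_real c.D) (dW_ne c.D) hGR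
          (1, conjTransportK c.D) (ctxSlotArchBox V c hpos₀ hpos₁)) =
      cmArchWeilRep (L : Type) finProdFinEquiv (frameD V) (frameD_real V) (frameD_ne V) (dW c.D) (dW_real c.D) (dW_ne c.D) hGR
        (1, conjTransportK c.D)
        (cmArchWeilRep (L : Type) finProdFinEquiv (frameD V) (frameD_real V) (frameD_ne V) (dW c.D) (dW_real c.D) (dW_ne c.D) hGR
          (UnitaryGroup.archSingle (↥(maximalRealSubfield L)) L (IsCMField.complexConj L) 3 (Matrix.diagonal (frameD V))
            (IsCMField.complexConj_ne_one L) (UnitaryGroup.complexConj_smul_infinitePlace (L : Type)) (cmPlaceOver (L : Type) b) u, 1)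
          (ctxSlotArchBox V c hpos₀ hpos₁)) := by
    rw [← Module.End.mul_apply, ← map_mul, hcomm, map_mul, Module.End.mul_apply]
  rw [LinearMap.map_smul, hswap, cmArchWeilRep_archSingle_slotArchBox_linePhi V c hGR h₁W hpos₀ hpos₁ hb u, LinearMap.map_smul, smul_comm]

/-! ## § 2 The line sides at `((archSingle u)^𝔸, 1)` on the conjugated plane -/

/-- line 2 at a one-place element on the thin-coset test function of `linePhi`: the scalar `det(u)^{ℓ′_b} · det(u)^{a₂ b}`. -/
theorem cmConjLineRepFin₀_one_archSingle_testFun {b : {v : InfinitePlace ↥(maximalRealSubfield L) // v.IsReal}}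
    (hb : b ≠ HypCensus.cmPlace (L : Type) ι₁) (u : archLocal (L : Type) 3 (Matrix.diagonal (frameD V)) (cmPlaceOver (L : Type) b))
    (x₂ : Fin 3 → ↥(maximalRealSubfield L)) (N : ℕ) :
    cmConjLineRepFin₀ (L : Type) finProdFinEquiv e₁ (frameD V) (frameD_real V) (frameD_ne V) (dW c.D) (dW_real c.D) (dW_ne c.D)
        (dW' c.D) (dW'_real c.D) (dW'_ne c.D) c.D.isoGL (isoGL_hg₀ c.D) hGR hGR₂ hGR₃ 1
        (UnitaryGroup.archToAdelic (↥(maximalRealSubfield L)) L (IsCMField.complexConj L) 3 (Matrix.diagonal (frameD V))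
          (UnitaryGroup.archSingle (↥(maximalRealSubfield L)) L (IsCMField.complexConj L) 3 (Matrix.diagonal (frameD V))
            (IsCMField.complexConj_ne_one L) (UnitaryGroup.complexConj_smul_infinitePlace (L : Type)) (cmPlaceOver (L : Type) b) u), 1)
        (testFun (↥(maximalRealSubfield L)) (Fin 3) (linePhi V (dW' c.D 0) (dW'_real c.D 0) (dW'_ne c.D 0) hpos₂) x₂ N) =
      ((((u : archLocal (L : Type) 3 (Matrix.diagonal (frameD V)) (cmPlaceOver (L : Type) b)) : GL (Fin 3) ℂ) : Matrix (Fin 3) (Fin 3) ℂ).det ^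
          defLambdaExponentConj V c.D hGR hGR₂ hGR₃ h₁W b hb *
        (((u : archLocal (L : Type) 3 (Matrix.diagonal (frameD V)) (cmPlaceOver (L : Type) b)) : GL (Fin 3) ℂ) : Matrix (Fin 3) (Fin 3) ℂ).det ^
          defExponentTwo V c hGR₂ hpos₂ b) •
      testFun (↥(maximalRealSubfield L)) (Fin 3) (linePhi V (dW' c.D 0) (dW'_real c.D 0) (dW'_ne c.D 0) hpos₂) x₂ N := by
  have key := cmPairRep_archToAdelic_eq_adelicTensorEnd (L : Type) e₁ (frameD V) (frameD_real V) (frameD_ne V)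
    (lineVec (L : Type) (dW' c.D 0)) (fun _ => dW'_real c.D 0) (fun _ => dW'_ne c.D 0) hGR₂
    (UnitaryGroup.archSingle (↥(maximalRealSubfield L)) L (IsCMField.complexConj L) 3 (Matrix.diagonal (frameD V))
      (IsCMField.complexConj_ne_one L) (UnitaryGroup.complexConj_smul_infinitePlace (L : Type)) (cmPlaceOver (L : Type) b) u) 1
  rw [map_one] at key
  have key2 := apply_testFun_of_eq_adelicTensorEnd key (linePhi V (dW' c.D 0) (dW'_real c.D 0) (dW'_ne c.D 0) hpos₂) x₂ N
  rw [linePhi_def, defExponentTwo_spec V c hGR₂ hpos₂ b hb u, testFun_smul, ← linePhi_def] at key2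
  rw [cmConjLineRepFin₀_apply_eq_smul_cmPairRep, map_one, map_one, MonoidHom.one_apply, one_mul, ← defLambdaCharConj_apply,
    defLambdaCharConj_eq_zpow V c.D hGR hGR₂ hGR₃ h₁W b hb u]
  erw [key2]
  rw [smul_smul]

/-- line 3 at a one-place element on the thin-coset test function of `linePhi`: the scalar `det(u)^{a₃ b}`. -/
theorem cmConjLineRepFin₁_one_archSingle_testFun {b : {v : InfinitePlace ↥(maximalRealSubfield L) // v.IsReal}}
    (hb : b ≠ HypCensus.cmPlace (L : Type) ι₁) (u : archLocal (L : Type) 3 (Matrix.diagonal (frameD V)) (cmPlaceOver (L : Type) b))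
    (x₃ : Fin 3 → ↥(maximalRealSubfield L)) (N : ℕ) :
    cmConjLineRepFin₁ (L : Type) finProdFinEquiv e₁ (frameD V) (frameD_real V) (frameD_ne V) (dW c.D) (dW_real c.D) (dW_ne c.D)
        (dW' c.D) (dW'_real c.D) (dW'_ne c.D) c.D.isoGL (isoGL_hg₀ c.D) hGR hGR₂ hGR₃ 1
        (UnitaryGroup.archToAdelic (↥(maximalRealSubfield L)) L (IsCMField.complexConj L) 3 (Matrix.diagonal (frameD V))
          (UnitaryGroup.archSingle (↥(maximalRealSubfield L)) L (IsCMField.complexConj L) 3 (Matrix.diagonal (frameD V))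
            (IsCMField.complexConj_ne_one L) (UnitaryGroup.complexConj_smul_infinitePlace (L : Type)) (cmPlaceOver (L : Type) b) u), 1)
        (testFun (↥(maximalRealSubfield L)) (Fin 3) (linePhi V (dW' c.D 1) (dW'_real c.D 1) (dW'_ne c.D 1) hpos₃) x₃ N) =
      (((u : archLocal (L : Type) 3 (Matrix.diagonal (frameD V)) (cmPlaceOver (L : Type) b)) : GL (Fin 3) ℂ) : Matrix (Fin 3) (Fin 3) ℂ).det ^
          defExponentThree V c hGR₃ hpos₃ b •
      testFun (↥(maximalRealSubfield L)) (Fin 3) (linePhi V (dW' c.D 1) (dW'_real c.D 1) (dW'_ne c.D 1) hpos₃) x₃ N := by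
  have key := cmPairRep_archToAdelic_eq_adelicTensorEnd (L : Type) e₁ (frameD V) (frameD_real V) (frameD_ne V)
    (lineVec (L : Type) (dW' c.D 1)) (fun _ => dW'_real c.D 1) (fun _ => dW'_ne c.D 1) hGR₃
    (UnitaryGroup.archSingle (↥(maximalRealSubfield L)) L (IsCMField.complexConj L) 3 (Matrix.diagonal (frameD V))
      (IsCMField.complexConj_ne_one L) (UnitaryGroup.complexConj_smul_infinitePlace (L : Type)) (cmPlaceOver (L : Type) b) u) 1
  rw [map_one] at key
  have key2 := apply_testFun_of_eq_adelicTensorEnd key (linePhi V (dW' c.D 1) (dW'_real c.D 1) (dW'_ne c.D 1) hpos₃) x₃ N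
  rw [linePhi_def, defExponentThree_spec V c hGR₃ hpos₃ b hb u, testFun_smul, ← linePhi_def] at key2
  rw [cmConjLineRepFin₁_apply_eq_smul_cmPairRep, map_one, map_one, MonoidHom.one_apply, one_mul, cmConjLineChar₁_apply_mk_one,
    Units.val_one, one_smul]
  erw [key2]

/-! ## § 3 The see-saw comparison on the conjugated tensor and the exponent identity, from (STRIP) ∧ (VT) -/

/-- **the see-saw comparison at a one-place element**, given the (STRIP) ∧ (VT) identification of the conjugated tensor of the two line test
functions ((K10)'s `hSV` texts, per context): `det(u)^{pairVacExponent b} = det(u)^{ℓ′_b} · det(u)^{a₂ b} · det(u)^{a₃ b}`. -/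
theorem det_zpow_pairVacExponent_eq_conj_of_strip_vt
    (Y : 𝓢((Fin (3 * 2) → mixedSpace (↥(NumberField.maximalRealSubfield (L : Type)))), ℂ))
    (F : FinSB (↥(NumberField.maximalRealSubfield (L : Type))) (Fin (3 * 2)))
    (hstrip : cmConjLineTensorFin (L : Type) finProdFinEquiv e₁ (frameD V) (frameD_real V) (frameD_ne V) (dW c.D) (dW_real c.D) (dW_ne c.D)
          (dW' c.D) (dW'_real c.D) (dW'_ne c.D) c.D.isoGL (isoGL_hg₀ c.D)
          (SupplyInstance.testFun (↥(NumberField.maximalRealSubfield (L : Type))) (Fin 3)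
            (linePhi V (dW' c.D 0) (dW'_real c.D 0) (dW'_ne c.D 0) hpos₂) (lineX₀ V (dW' c.D 0) (dW'_real c.D 0) (dW'_ne c.D 0) hpos₂) 1)
          (SupplyInstance.testFun (↥(NumberField.maximalRealSubfield (L : Type))) (Fin 3)
            (linePhi V (dW' c.D 1) (dW'_real c.D 1) (dW'_ne c.D 1) hpos₃) (lineX₀ V (dW' c.D 1) (dW'_real c.D 1) (dW'_ne c.D 1) hpos₃) 1) =
        piSchwartzBruhatEquiv (↥(NumberField.maximalRealSubfield (L : Type))) (Fin (3 * 2)) (Y ⊗ₜ F))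
    (a : ℂ)
    (hY : Y = a • HypCensus.cmArchWeilRep (L : Type) finProdFinEquiv (frameD V) (frameD_real V) (frameD_ne V) (dW c.D) (dW_real c.D) (dW_ne c.D)
        hGR (1, conjTransportK c.D) (ctxSlotArchBox V c hpos₀ hpos₁))
    {b : {v : InfinitePlace ↥(maximalRealSubfield L) // v.IsReal}}
    (hb : b ≠ HypCensus.cmPlace (L : Type) ι₁) (u : archLocal (L : Type) 3 (Matrix.diagonal (frameD V)) (cmPlaceOver (L : Type) b)) :
    (((u : archLocal (L : Type) 3 (Matrix.diagonal (frameD V)) (cmPlaceOver (L : Type) b)) : GL (Fin 3) ℂ) : Matrix (Fin 3) (Fin 3) ℂ).det ^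
        pairVacExponent V c.D hGR h₁W b =
      (((u : archLocal (L : Type) 3 (Matrix.diagonal (frameD V)) (cmPlaceOver (L : Type) b)) : GL (Fin 3) ℂ) : Matrix (Fin 3) (Fin 3) ℂ).det ^
          defLambdaExponentConj V c.D hGR hGR₂ hGR₃ h₁W b hb *
        (((u : archLocal (L : Type) 3 (Matrix.diagonal (frameD V)) (cmPlaceOver (L : Type) b)) : GL (Fin 3) ℂ) : Matrix (Fin 3) (Fin 3) ℂ).det ^
          defExponentTwo V c hGR₂ hpos₂ b *
        (((u : archLocal (L : Type) 3 (Matrix.diagonal (frameD V)) (cmPlaceOver (L : Type) b)) : GL (Fin 3) ℂ) : Matrix (Fin 3) (Fin 3) ℂ).det ^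
          defExponentThree V c hGR₃ hpos₃ b := by
  -- the two line test functions and their (non-zero) conjugated see-saw tensor
  have hφ₂ : testFun (↥(maximalRealSubfield L)) (Fin 3) (linePhi V (dW' c.D 0) (dW'_real c.D 0) (dW'_ne c.D 0) hpos₂)
      (lineX₀ V (dW' c.D 0) (dW'_real c.D 0) (dW'_ne c.D 0) hpos₂) 1 ≠ 0 :=
    testFun_ne_zero _ (linePhi_archEmb_lineX₀_ne_zero V (dW' c.D 0) (dW'_real c.D 0) (dW'_ne c.D 0) hpos₂) one_ne_zero
  have hφ₃ : testFun (↥(maximalRealSubfield L)) (Fin 3) (linePhi V (dW' c.D 1) (dW'_real c.D 1) (dW'_ne c.D 1) hpos₃)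
      (lineX₀ V (dW' c.D 1) (dW'_real c.D 1) (dW'_ne c.D 1) hpos₃) 1 ≠ 0 :=
    testFun_ne_zero _ (linePhi_archEmb_lineX₀_ne_zero V (dW' c.D 1) (dW'_real c.D 1) (dW'_ne c.D 1) hpos₃) one_ne_zero
  have hX := cmConjLineTensorFin_ne_zero V c.D hφ₂ hφ₃
  -- the conjugated see-saw restriction at `((archSingle u)^𝔸, g·diag(1,1)·g⁻¹)`, trivial twists
  have hss := cmPairRepTwist_conjTorusIdeles_cmConjLineTensorFin (L : Type) finProdFinEquiv e₁ (frameD V) (frameD_real V) (frameD_ne V)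
    (dW c.D) (dW_real c.D) (dW_ne c.D) (dW' c.D) (dW'_real c.D) (dW'_ne c.D) c.D.isoGL (isoGL_hg₀ c.D) hGR hGR₂ hGR₃ 1 1 1
    (fun _ _ _ => by rw [MonoidHom.one_apply, MonoidHom.one_apply, MonoidHom.one_apply, one_mul])
    (UnitaryGroup.archToAdelic (↥(maximalRealSubfield L)) L (IsCMField.complexConj L) 3 (Matrix.diagonal (frameD V))
      (UnitaryGroup.archSingle (↥(maximalRealSubfield L)) L (IsCMField.complexConj L) 3 (Matrix.diagonal (frameD V))
      (IsCMField.complexConj_ne_one L) (UnitaryGroup.complexConj_smul_infinitePlace (L : Type)) (cmPlaceOver (L : Type) b) u)) 1 1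
    (testFun (↥(maximalRealSubfield L)) (Fin 3) (linePhi V (dW' c.D 0) (dW'_real c.D 0) (dW'_ne c.D 0) hpos₂)
      (lineX₀ V (dW' c.D 0) (dW'_real c.D 0) (dW'_ne c.D 0) hpos₂) 1)
    (testFun (↥(maximalRealSubfield L)) (Fin 3) (linePhi V (dW' c.D 1) (dW'_real c.D 1) (dW'_ne c.D 1) hpos₃)
      (lineX₀ V (dW' c.D 1) (dW'_real c.D 1) (dW'_ne c.D 1) hpos₃) 1)
  have h11 : cmConjPlaneTorusIdeles (L : Type) (dW c.D) (dW' c.D) c.D.isoGL (isoGL_hg₀ c.D) (1, 1) = 1 := map_one _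
  rw [cmPairRepTwist_apply_eq_smul, MonoidHom.one_apply, Units.val_one, one_smul, h11,
    cmConjLineRepFin₀_one_archSingle_testFun V c hGR hGR₂ hGR₃ h₁W hpos₂ hb u _ 1,
    cmConjLineRepFin₁_one_archSingle_testFun V c hGR hGR₂ hGR₃ hpos₃ hb u _ 1, LinearMap.map_smul₂, LinearMap.map_smul, smul_smul] at hss
  -- the big side on the same vector, through its (STRIP) ∧ (VT) identification
  have key := cmPairRep_archToAdelic_eq_adelicTensorEnd (L : Type) finProdFinEquiv (frameD V) (frameD_real V) (frameD_ne V) (dW c.D)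
    (dW_real c.D) (dW_ne c.D) hGR
    (UnitaryGroup.archSingle (↥(maximalRealSubfield L)) L (IsCMField.complexConj L) 3 (Matrix.diagonal (frameD V))
      (IsCMField.complexConj_ne_one L) (UnitaryGroup.complexConj_smul_infinitePlace (L : Type)) (cmPlaceOver (L : Type) b) u) 1
  rw [map_one] at key
  have hbig := LinearMap.congr_fun key
    (cmConjLineTensorFin (L : Type) finProdFinEquiv e₁ (frameD V) (frameD_real V) (frameD_ne V) (dW c.D) (dW_real c.D) (dW_ne c.D)
      (dW' c.D) (dW'_real c.D) (dW'_ne c.D) c.D.isoGL (isoGL_hg₀ c.D)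
      (testFun (↥(maximalRealSubfield L)) (Fin 3) (linePhi V (dW' c.D 0) (dW'_real c.D 0) (dW'_ne c.D 0) hpos₂)
        (lineX₀ V (dW' c.D 0) (dW'_real c.D 0) (dW'_ne c.D 0) hpos₂) 1)
      (testFun (↥(maximalRealSubfield L)) (Fin 3) (linePhi V (dW' c.D 1) (dW'_real c.D 1) (dW'_ne c.D 1) hpos₃)
        (lineX₀ V (dW' c.D 1) (dW'_real c.D 1) (dW'_ne c.D 1) hpos₃) 1))
  rw [hstrip, adelicTensorEnd_apply_tmul, LinearMap.id_apply, cmArchWeilRep_archSingle_of_vt V c hGR h₁W hpos₀ hpos₁ Y a hY hb u,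
    ← TensorProduct.smul_tmul', map_smul, ← hstrip] at hbig
  -- compare
  erw [hbig] at hss
  exact smul_left_injective ℂ hX (hss.trans (by ring_nf))

/-- **(C-Σ)′ FROM (STRIP) ∧ (VT): at every definite place the pair's vacuum exponent is the sum of the two CONJUGATED lines' exponents and the
conjugated see-saw exponent.** -/
theorem pairVacExponent_eq_conj_of_strip_vt
    (Y : 𝓢((Fin (3 * 2) → mixedSpace (↥(NumberField.maximalRealSubfield (L : Type)))), ℂ))
    (F : FinSB (↥(NumberField.maximalRealSubfield (L : Type))) (Fin (3 * 2)))
    (hstrip : cmConjLineTensorFin (L : Type) finProdFinEquiv e₁ (frameD V) (frameD_real V) (frameD_ne V) (dW c.D) (dW_real c.D) (dW_ne c.D)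
          (dW' c.D) (dW'_real c.D) (dW'_ne c.D) c.D.isoGL (isoGL_hg₀ c.D)
          (SupplyInstance.testFun (↥(NumberField.maximalRealSubfield (L : Type))) (Fin 3)
            (linePhi V (dW' c.D 0) (dW'_real c.D 0) (dW'_ne c.D 0) hpos₂) (lineX₀ V (dW' c.D 0) (dW'_real c.D 0) (dW'_ne c.D 0) hpos₂) 1)
          (SupplyInstance.testFun (↥(NumberField.maximalRealSubfield (L : Type))) (Fin 3)
            (linePhi V (dW' c.D 1) (dW'_real c.D 1) (dW'_ne c.D 1) hpos₃) (lineX₀ V (dW' c.D 1) (dW'_real c.D 1) (dW'_ne c.D 1) hpos₃) 1) =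
        piSchwartzBruhatEquiv (↥(NumberField.maximalRealSubfield (L : Type))) (Fin (3 * 2)) (Y ⊗ₜ F))
    (a : ℂ)
    (hY : Y = a • HypCensus.cmArchWeilRep (L : Type) finProdFinEquiv (frameD V) (frameD_real V) (frameD_ne V) (dW c.D) (dW_real c.D) (dW_ne c.D)
        hGR (1, conjTransportK c.D) (ctxSlotArchBox V c hpos₀ hpos₁))
    {b : {v : InfinitePlace ↥(maximalRealSubfield L) // v.IsReal}} (hb : b ≠ HypCensus.cmPlace (L : Type) ι₁) :
    pairVacExponent V c.D hGR h₁W b =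
      defExponentTwo V c hGR₂ hpos₂ b + defExponentThree V c hGR₃ hpos₃ b + defLambdaExponentConj V c.D hGR hGR₂ hGR₃ h₁W b hb := by
  have key : ∀ z : ℂ, ‖z‖ = 1 → z ^ (pairVacExponent V c.D hGR h₁W b -
      (defExponentTwo V c hGR₂ hpos₂ b + defExponentThree V c hGR₃ hpos₃ b + defLambdaExponentConj V c.D hGR hGR₂ hGR₃ h₁W b hb)) = 1 := by
    intro z hz
    have hz0 : z ≠ 0 := norm_ne_zero_iff.mp (by rw [hz]; exact one_ne_zero)
    obtain ⟨u, hu⟩ := exists_archLocal_det_eq V hb z hz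
    have h := det_zpow_pairVacExponent_eq_conj_of_strip_vt V c hGR hGR₂ hGR₃ h₁W hpos₀ hpos₁ hpos₂ hpos₃ Y F hstrip a hY hb u
    rw [hu, ← zpow_add₀ hz0, ← zpow_add₀ hz0] at h
    rw [zpow_sub₀ hz0, h, div_eq_one_iff_eq (zpow_ne_zero _ hz0)]
    congr 1; ring
  have h0 := int_eq_zero_of_forall_norm_one_zpow_eq_one _ key
  omega

/-- **hence line 2's R2 value IS binder-2's (V-val) normalisation**: `nVR₂ (w b) = −pairVacExponent b` for `b ≠ v₁`. -/
theorem nVR₂_eq_neg_pairVacExponent_of_strip_vt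
    (Y : 𝓢((Fin (3 * 2) → mixedSpace (↥(NumberField.maximalRealSubfield (L : Type)))), ℂ))
    (F : FinSB (↥(NumberField.maximalRealSubfield (L : Type))) (Fin (3 * 2)))
    (hstrip : cmConjLineTensorFin (L : Type) finProdFinEquiv e₁ (frameD V) (frameD_real V) (frameD_ne V) (dW c.D) (dW_real c.D) (dW_ne c.D)
          (dW' c.D) (dW'_real c.D) (dW'_ne c.D) c.D.isoGL (isoGL_hg₀ c.D)
          (SupplyInstance.testFun (↥(NumberField.maximalRealSubfield (L : Type))) (Fin 3)
            (linePhi V (dW' c.D 0) (dW'_real c.D 0) (dW'_ne c.D 0) hpos₂) (lineX₀ V (dW' c.D 0) (dW'_real c.D 0) (dW'_ne c.D 0) hpos₂) 1)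
          (SupplyInstance.testFun (↥(NumberField.maximalRealSubfield (L : Type))) (Fin 3)
            (linePhi V (dW' c.D 1) (dW'_real c.D 1) (dW'_ne c.D 1) hpos₃) (lineX₀ V (dW' c.D 1) (dW'_real c.D 1) (dW'_ne c.D 1) hpos₃) 1) =
        piSchwartzBruhatEquiv (↥(NumberField.maximalRealSubfield (L : Type))) (Fin (3 * 2)) (Y ⊗ₜ F))
    (a : ℂ)
    (hY : Y = a • HypCensus.cmArchWeilRep (L : Type) finProdFinEquiv (frameD V) (frameD_real V) (frameD_ne V) (dW c.D) (dW_real c.D) (dW_ne c.D)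
        hGR (1, conjTransportK c.D) (ctxSlotArchBox V c hpos₀ hpos₁))
    {b : {v : InfinitePlace ↥(maximalRealSubfield L) // v.IsReal}} (hb : b ≠ HypCensus.cmPlace (L : Type) ι₁) :
    nVR₂ V c hGR hGR₂ hGR₃ h₁W hpos₂ hpos₃ (cmPlaceOver (L : Type) b).1 = -pairVacExponent V c.D hGR h₁W b := by
  rw [nVR₂_of_ne V c hGR hGR₂ hGR₃ h₁W hpos₂ hpos₃ hb,
    pairVacExponent_eq_conj_of_strip_vt V c hGR hGR₂ hGR₃ h₁W hpos₀ hpos₁ hpos₂ hpos₃ Y F hstrip a hY hb]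
  ring

/-- **THE R1/R2 CONSISTENCY off `v₁`**: the V-type read off lines 0, 1 (`nVR`, #CA33) and the value line 2 needs at pin R2 (`nVR₂`, #CA49) AGREE at
every complex place over a real `b ≠ v₁` — both are `−pairVacExponent b` (#CA36 and § 3 here). -/
theorem nVR_eq_nVR₂_of_strip_vt
    (Y : 𝓢((Fin (3 * 2) → mixedSpace (↥(NumberField.maximalRealSubfield (L : Type)))), ℂ))
    (F : FinSB (↥(NumberField.maximalRealSubfield (L : Type))) (Fin (3 * 2)))
    (hstrip : cmConjLineTensorFin (L : Type) finProdFinEquiv e₁ (frameD V) (frameD_real V) (frameD_ne V) (dW c.D) (dW_real c.D) (dW_ne c.D)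
          (dW' c.D) (dW'_real c.D) (dW'_ne c.D) c.D.isoGL (isoGL_hg₀ c.D)
          (SupplyInstance.testFun (↥(NumberField.maximalRealSubfield (L : Type))) (Fin 3)
            (linePhi V (dW' c.D 0) (dW'_real c.D 0) (dW'_ne c.D 0) hpos₂) (lineX₀ V (dW' c.D 0) (dW'_real c.D 0) (dW'_ne c.D 0) hpos₂) 1)
          (SupplyInstance.testFun (↥(NumberField.maximalRealSubfield (L : Type))) (Fin 3)
            (linePhi V (dW' c.D 1) (dW'_real c.D 1) (dW'_ne c.D 1) hpos₃) (lineX₀ V (dW' c.D 1) (dW'_real c.D 1) (dW'_ne c.D 1) hpos₃) 1) =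
        piSchwartzBruhatEquiv (↥(NumberField.maximalRealSubfield (L : Type))) (Fin (3 * 2)) (Y ⊗ₜ F))
    (a : ℂ)
    (hY : Y = a • HypCensus.cmArchWeilRep (L : Type) finProdFinEquiv (frameD V) (frameD_real V) (frameD_ne V) (dW c.D) (dW_real c.D) (dW_ne c.D)
        hGR (1, conjTransportK c.D) (ctxSlotArchBox V c hpos₀ hpos₁))
    {b : {v : InfinitePlace ↥(maximalRealSubfield L) // v.IsReal}} (hb : b ≠ HypCensus.cmPlace (L : Type) ι₁) :
    nVR V c hGR hGR₀ hGR₁ h₁W hpos₀ hpos₁ (cmPlaceOver (L : Type) b).1 = nVR₂ V c hGR hGR₂ hGR₃ h₁W hpos₂ hpos₃ (cmPlaceOver (L : Type) b).1 := by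
  rw [nVR_eq_neg_pairVacExponent V c hGR hGR₀ hGR₁ h₁W hpos₀ hpos₁ hb,
    nVR₂_eq_neg_pairVacExponent_of_strip_vt V c hGR hGR₂ hGR₃ h₁W hpos₀ hpos₁ hpos₂ hpos₃ Y F hstrip a hY hb]

end SigmaConj

end HodgeCM.Model

/-! ## § 4 The guarded family form, consuming (K10)'s `hSV` verbatim -/

namespace HodgeCM.Model.SInstance

open HodgeCM.Model HodgeCM.Model.ArchSideTerm

variable
  (hGR : ∀ {L : CMField} {ι₁ : L →+* ℂ} (V : HermSpace3 L ι₁) (c : SeesawCtx L),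
    (cmSplittingDatum (L : Type) finProdFinEquiv (frameD V) (frameD_real V) (frameD_ne V) (dW c.D) (dW_real c.D)
      (dW_ne c.D)).CompatibleSplitting)
  (hGR₀ : ∀ {L : CMField} {ι₁ : L →+* ℂ} (V : HermSpace3 L ι₁) (c : SeesawCtx L),
    (cmSplittingDatum (L : Type) (ArchSideTerm.e₁) (frameD V) (frameD_real V) (frameD_ne V) (lineVec (L : Type) (dW c.D 0))
      (fun _ => dW_real c.D 0) (fun _ => dW_ne c.D 0)).CompatibleSplitting)
  (hGR₁ : ∀ {L : CMField} {ι₁ : L →+* ℂ} (V : HermSpace3 L ι₁) (c : SeesawCtx L),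
    (cmSplittingDatum (L : Type) (ArchSideTerm.e₁) (frameD V) (frameD_real V) (frameD_ne V) (lineVec (L : Type) (dW c.D 1))
      (fun _ => dW_real c.D 1) (fun _ => dW_ne c.D 1)).CompatibleSplitting)
  (hGR₂ : ∀ {L : CMField} {ι₁ : L →+* ℂ} (V : HermSpace3 L ι₁) (c : SeesawCtx L),
    (cmSplittingDatum (L : Type) (ArchSideTerm.e₁) (frameD V) (frameD_real V) (frameD_ne V) (lineVec (L : Type) (dW' c.D 0))
      (fun _ => dW'_real c.D 0) (fun _ => dW'_ne c.D 0)).CompatibleSplitting)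
  (hGR₃ : ∀ {L : CMField} {ι₁ : L →+* ℂ} (V : HermSpace3 L ι₁) (c : SeesawCtx L),
    (cmSplittingDatum (L : Type) (ArchSideTerm.e₁) (frameD V) (frameD_real V) (frameD_ne V) (lineVec (L : Type) (dW' c.D 1))
      (fun _ => dW'_real c.D 1) (fun _ => dW'_ne c.D 1)).CompatibleSplitting)
  (hSV : ∀ {L : CMField} {ι₁ : L →+* ℂ} (V : HermSpace3 L ι₁) (c : SeesawCtx L) (hc : SInstance.GOG V c),
    ∃ (Y : 𝓢((Fin (3 * 2) → mixedSpace (↥(NumberField.maximalRealSubfield (L : Type)))), ℂ))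
      (F : FinSB (↥(NumberField.maximalRealSubfield (L : Type))) (Fin (3 * 2))) (a : ℂ),
      cmConjLineTensorFin (L : Type) finProdFinEquiv e₁ (frameD V) (frameD_real V) (frameD_ne V) (dW c.D) (dW_real c.D) (dW_ne c.D)
          (dW' c.D) (dW'_real c.D) (dW'_ne c.D) c.D.isoGL (isoGL_hg₀ c.D)
          (SupplyInstance.testFun (↥(NumberField.maximalRealSubfield (L : Type))) (Fin 3)
            (linePhi V (dW' c.D 0) (dW'_real c.D 0) (dW'_ne c.D 0) (SInstance.hpos_GOG V c hc).2.2.1)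
            (lineX₀ V (dW' c.D 0) (dW'_real c.D 0) (dW'_ne c.D 0) (SInstance.hpos_GOG V c hc).2.2.1) 1)
          (SupplyInstance.testFun (↥(NumberField.maximalRealSubfield (L : Type))) (Fin 3)
            (linePhi V (dW' c.D 1) (dW'_real c.D 1) (dW'_ne c.D 1) (SInstance.hpos_GOG V c hc).2.2.2)
            (lineX₀ V (dW' c.D 1) (dW'_real c.D 1) (dW'_ne c.D 1) (SInstance.hpos_GOG V c hc).2.2.2) 1) =
        piSchwartzBruhatEquiv (↥(NumberField.maximalRealSubfield (L : Type))) (Fin (3 * 2)) (Y ⊗ₜ F) ∧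
      Y = a • HypCensus.cmArchWeilRep (L : Type) finProdFinEquiv (frameD V) (frameD_real V) (frameD_ne V) (dW c.D) (dW_real c.D) (dW_ne c.D)
        (hGR V c) (1, conjTransportK c.D) (ctxSlotArchBox V c (SInstance.hpos_GOG V c hc).1 (SInstance.hpos_GOG V c hc).2.1))

include hSV in
/-- **(C-Σ)′ UNDER THE OG GUARD, from (K10)'s `hSV`**: `pairVacExponent b = a₂ b + a₃ b + ℓ′_b` for every `b ≠ v₁`. -/
theorem pairVacExponent_eq_conj_of_GOG {L : CMField} {ι₁ : L →+* ℂ} (V : HermSpace3 L ι₁) (c : SeesawCtx L) (hG : GOG V c)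
    {b : {v : InfinitePlace ↥(maximalRealSubfield L) // v.IsReal}} (hb : b ≠ HypCensus.cmPlace (L : Type) ι₁) :
    pairVacExponent V c.D (hGR V c) (hG_GOG V c hG) b =
      defExponentTwo V c (hGR₂ V c) (hpos_GOG V c hG).2.2.1 b + defExponentThree V c (hGR₃ V c) (hpos_GOG V c hG).2.2.2 b +
        defLambdaExponentConj V c.D (hGR V c) (hGR₂ V c) (hGR₃ V c) (hG_GOG V c hG) b hb := by
  obtain ⟨Y, F, a, hstrip, hY⟩ := hSV V c hG
  exact pairVacExponent_eq_conj_of_strip_vt V c (hGR V c) (hGR₂ V c) (hGR₃ V c) (hG_GOG V c hG) (hpos_GOG V c hG).1 (hpos_GOG V c hG).2.1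
    (hpos_GOG V c hG).2.2.1 (hpos_GOG V c hG).2.2.2 Y F hstrip a hY hb

include hSV in
/-- **THE R1/R2 CONSISTENCY UNDER THE OG GUARD**: `nVR (w b) = nVR₂ (w b)` at every complex place over a real `b ≠ v₁`. -/
theorem nVR_eq_nVR₂_of_GOG {L : CMField} {ι₁ : L →+* ℂ} (V : HermSpace3 L ι₁) (c : SeesawCtx L) (hG : GOG V c)
    {b : {v : InfinitePlace ↥(maximalRealSubfield L) // v.IsReal}} (hb : b ≠ HypCensus.cmPlace (L : Type) ι₁) :
    nVR V c (hGR V c) (hGR₀ V c) (hGR₁ V c) (hG_GOG V c hG) (hpos_GOG V c hG).1 (hpos_GOG V c hG).2.1 (cmPlaceOver (L : Type) b).1 =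
      nVR₂ V c (hGR V c) (hGR₂ V c) (hGR₃ V c) (hG_GOG V c hG) (hpos_GOG V c hG).2.2.1 (hpos_GOG V c hG).2.2.2 (cmPlaceOver (L : Type) b).1 := by
  obtain ⟨Y, F, a, hstrip, hY⟩ := hSV V c hG
  exact nVR_eq_nVR₂_of_strip_vt V c (hGR V c) (hGR₀ V c) (hGR₁ V c) (hGR₂ V c) (hGR₃ V c) (hG_GOG V c hG) (hpos_GOG V c hG).1
    (hpos_GOG V c hG).2.1 (hpos_GOG V c hG).2.2.1 (hpos_GOG V c hG).2.2.2 Y F hstrip a hY hb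

end HodgeCM.Model.SInstance

end
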